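import Summits.BirchSwinnertonDyer.BirchSwinnertonDyer.Theses.AdditiveKolyvaginRoad
import Summits.BirchSwinnertonDyer.Rank1Residual.Additive.DictionaryUniform
import Summits.BirchSwinnertonDyer.Rank1Residual.X11b.Three.KolyvaginLine
import Summits.BirchSwinnertonDyer.BirchSwinnertonDyer.Theorems.AdditiveKolyvaginRoadBottomRankOneAdditiveClassOfPoint

/-! # BottomRankOneAdditive — line `birth`, skeleton v3 (lead prover bsd-wall-akr-p3 g0, 2026-08-27)
v3 = v2 with the glue stub `stub_kolyvaginClassOneOfNotPDiv` DISCHARGED by the landed theorem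
`Theorems.AdditiveKoly.stub_kolyvaginClassOneOfNotPDiv` (p567354, `…BottomRankOneAdditiveClassOfPoint.lean`); 2 open stubs remain.

Crux item stmt-BirchSwinnertonDyer-21397 (route AdditiveKolyvaginRoad, rank 10):
`Summit.BirchSwinnertonDyer.BirchSwinnertonDyer.Theses.AdditiveKolyvaginRoad.BottomRankOneAdditive`.

RESHAPE v1 → v2 (same line, same composition idea = cut BY LOCAL INERTIAL TYPE at the additive prime `p`,
`Rank1Residual.Additive.sub_exhaustive`; what changed and why):
* the COHOMOLOGICAL layer of the crux is split off as the glue stub `stub_kolyvaginClassOneOfNotPDiv` — PROVABLE NOW from tree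
  theorems (McCallum 1991 Cor. 4.5 both ways for concrete data `KolyCert.kolyvaginClass_ne_zero_iff`; Gross 1991 Lemma 4.3 at
  the ring class field from `ρ̄_{E,p}` onto `RingClassNoTorsion.isAdmissible_pointsSubgroup`; Gross Prop. 3.6 / McCallum (4)
  at level `1` `Theorems.Prop44.toGeomPoints_derivedPoint_mem_invPoints`; Darmon Thm. 3.6 at conductor `1`
  `exists_kolyvaginHeegnerData_one` ∘ `phi_heegnerTau_mem_singularModuliField_holds`): on a ♯ frame, `c(1) ≠ 0` for SOME
  conductor-`1` datum ⟸ `P(1) = y_K ∉ p·E(K[1])` for EVERY conductor-`1` datum;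
* the two OPEN by-type stubs now conclude the POINT statement `∀ d, ¬ Koly.PDiv d p 1` (McCallum's `p ∤ P_1`, i.e. the Heegner
  point `y_K = Tr_{K[1]/K} y(1)` is not divisible by `p` in `E(K[1])`, equivalently — `Koly.pDiv_one_iff_exists_zsmul_eq` with
  `E(K[1])[p] = 0` — not divisible by `p` in `E(K)`): the Gross–Zagier ∕ BSD currency in which every printed or preprinted
  anchor (SU, Skinner–Zhang, Fouquet–Wan, BCGS) delivers its conclusion;
* the wild cell `SubW` is DISCHARGED (empty at an additive `p ≥ 5`: `Additive.not_subW_of_addv_of_five_le`), so stub NA is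
  stated on the supercuspidal cell `SubTprime` alone (`Additive.subM_or_subGord_or_subTprime_of_addv`).
Stubs: `stub_heegnerPointIndivisibleAbelianType` (OPEN, locus `SubM ∨ SubGord`), `stub_heegnerPointIndivisibleSupercuspidalType`
(OPEN, locus `SubTprime` — the hardest: no anchor in print or preprint, MEMO-anchor-v1 §2 row 5),
`stub_kolyvaginClassOneOfNotPDiv` (GLUE, proved in work/stubs/, landed `--supports`). Composition `BottomRankOneAdditive_of`
proves the crux BY NAME. Anchor map: Cruxes/LevelKolyvaginSystemsAdditive/MEMO-anchor-v1.md; dead lines D1–D6 honoured. -/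

set_option autoImplicit false

noncomputable section

open scoped Classical

open WeierstrassCurve NumberField Literature.NumberTheory.EllipticCurves
  Literature.NumberTheory.EllipticCurves.ModularForms Literature.NumberTheory.EllipticCurves.Rank1Residual
  Summit.BirchSwinnertonDyer.Rank1Residual Summit.BirchSwinnertonDyer.Rank1Residual.Additive
  Summit.BirchSwinnertonDyer.Rank1Residual.X11b.Three
  Summit.BirchSwinnertonDyer.BirchSwinnertonDyer.Theses.AdditiveKolyvaginRoad

namespace Summit.BirchSwinnertonDyer.BirchSwinnertonDyer.Cruxes.BottomRankOneAdditive.Birth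

/-- stub AB (OPEN): on the ABELIAN-TYPE locus (`SubM ∨ SubGord`: ρ_{E,p}|G_p semistable over an abelian tame extension,
e ∣ p − 1), at a ♯ additive frame with `#Sel_p(E/K) = p`, the conductor-1 derived Heegner point `P(1) = y_K` of every
Kolyvagin–Heegner datum is NOT divisible by `p` in `E(K[1])`. In print for the semistable TWIST only (e = 2 rows:
SU 2014 ∕ Skinner–Zhang 2014 ∕ Da Ronche 2025, modulo an unprinted twist transport); e ∈ {3,4,6}: FW preprint only. -/
theorem stub_heegnerPointIndivisibleAbelianType :
  ∀ (W : WeierstrassCurve ℚ) [W.IsElliptic] [W.IsGloballyMinimal] [NeZero (W.conductorNorm ℤ)]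
    (p : ℕ) [Fact p.Prime] (K : Type) [Field K] [NumberField K]
    (Dt : ModularParametrizationData W (W.conductorNorm ℤ)) (β : ℤ) (ι : K →+* ℂ),
    5 ≤ p → Addv W p → (Summit.BirchSwinnertonDyer.Rank1Residual.Additive.SubM W p ∨
      Summit.BirchSwinnertonDyer.Rank1Residual.Additive.SubGord W p) → W.HasSurjectiveModNGaloisRep p →
    (∀ (ℓ : ℕ) [Fact ℓ.Prime], W.HasMultiplicativeReductionAtPrime ℓ →
      ¬ p ∣ padicValInt ℓ W.minimalDiscriminantInt) →
    (∃ (ℓ₁ ℓ₂ : ℕ) (_ : Fact ℓ₁.Prime) (_ : Fact ℓ₂.Prime), ℓ₁ ≠ ℓ₂ ∧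
      W.HasMultiplicativeReductionAtPrime ℓ₁ ∧ W.HasMultiplicativeReductionAtPrime ℓ₂) →
    ¬ p ∣ W.tamagawaProduct → W.analyticRank = 1 →
    IsImaginaryQuadratic K → Odd (NumberField.discr K) → NumberField.discr K < -4 →
    SatisfiesHeegnerHypothesis (W.conductorNorm ℤ) K →
    (W.quadraticTwist (NumberField.discr K : ℚ)).entireLFunction 1 ≠ 0 →
    (4 * (W.conductorNorm ℤ : ℤ)) ∣ β ^ 2 - NumberField.discr K → ¬ (p : ℤ) ∣ Dt.c →
    Nat.card (WeierstrassCurve.selmerGroup (W.baseChange K) (p : ℤ)) = p →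
    ∀ d : KolyvaginHeegnerData Dt β ι 1, ¬ Koly.PDiv d p 1 := by
  sorry

/-- stub NA (OPEN, hardest): on the SUPERCUSPIDAL locus (`SubTprime`: e ∤ p − 1, ρ̄_{E,p}|G_p irreducible, potentially
supersingular), at a ♯ additive frame with `#Sel_p(E/K) = p`, the conductor-1 derived Heegner point `P(1) = y_K` of every
Kolyvagin–Heegner datum is NOT divisible by `p` in `E(K[1])`. No anchor in print or preprint (MEMO-anchor-v1 §2 row 5). -/
theorem stub_heegnerPointIndivisibleSupercuspidalType :
  ∀ (W : WeierstrassCurve ℚ) [W.IsElliptic] [W.IsGloballyMinimal] [NeZero (W.conductorNorm ℤ)]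
    (p : ℕ) [Fact p.Prime] (K : Type) [Field K] [NumberField K]
    (Dt : ModularParametrizationData W (W.conductorNorm ℤ)) (β : ℤ) (ι : K →+* ℂ),
    5 ≤ p → Addv W p → Summit.BirchSwinnertonDyer.Rank1Residual.Additive.SubTprime W p →
    W.HasSurjectiveModNGaloisRep p →
    (∀ (ℓ : ℕ) [Fact ℓ.Prime], W.HasMultiplicativeReductionAtPrime ℓ →
      ¬ p ∣ padicValInt ℓ W.minimalDiscriminantInt) →
    (∃ (ℓ₁ ℓ₂ : ℕ) (_ : Fact ℓ₁.Prime) (_ : Fact ℓ₂.Prime), ℓ₁ ≠ ℓ₂ ∧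
      W.HasMultiplicativeReductionAtPrime ℓ₁ ∧ W.HasMultiplicativeReductionAtPrime ℓ₂) →
    ¬ p ∣ W.tamagawaProduct → W.analyticRank = 1 →
    IsImaginaryQuadratic K → Odd (NumberField.discr K) → NumberField.discr K < -4 →
    SatisfiesHeegnerHypothesis (W.conductorNorm ℤ) K →
    (W.quadraticTwist (NumberField.discr K : ℚ)).entireLFunction 1 ≠ 0 →
    (4 * (W.conductorNorm ℤ : ℤ)) ∣ β ^ 2 - NumberField.discr K → ¬ (p : ℤ) ∣ Dt.c →
    Nat.card (WeierstrassCurve.selmerGroup (W.baseChange K) (p : ℤ)) = p →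
    ∀ d : KolyvaginHeegnerData Dt β ι 1, ¬ Koly.PDiv d p 1 := by
  sorry

/-- stub GLUE — DISCHARGED (p567354): McCallum's cocycle layer at conductor `1`, now the landed theorem
`Theorems.AdditiveKoly.stub_kolyvaginClassOneOfNotPDiv` (same signature). -/
theorem stub_kolyvaginClassOneOfNotPDiv :
  ∀ (W : WeierstrassCurve ℚ) [W.IsElliptic] [W.IsGloballyMinimal] [NeZero (W.conductorNorm ℤ)]
    (p : ℕ) [Fact p.Prime] (K : Type) [Field K] [NumberField K]
    (Dt : ModularParametrizationData W (W.conductorNorm ℤ)) (β : ℤ) (ι : K →+* ℂ),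
    5 ≤ p → W.HasSurjectiveModNGaloisRep p → IsImaginaryQuadratic K → NumberField.discr K < -4 →
    SatisfiesHeegnerHypothesis (W.conductorNorm ℤ) K →
    (4 * (W.conductorNorm ℤ : ℤ)) ∣ β ^ 2 - NumberField.discr K →
    (∀ d : KolyvaginHeegnerData Dt β ι 1, ¬ Koly.PDiv d p 1) →
    ∃ d : KolyvaginHeegnerData Dt β ι 1, d.kolyvaginClass (Fact.out : p.Prime) 1 ≠ 0 :=
  Summit.BirchSwinnertonDyer.BirchSwinnertonDyer.Theorems.AdditiveKoly.stub_kolyvaginClassOneOfNotPDiv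

/-- COMPOSITION (kernel-checked, no sorry of its own): the crux BY NAME from the three stubs, by the trichotomy of type
cells at an additive `p ≥ 5` (`Additive.subM_or_subGord_or_subTprime_of_addv`: the wild cell `SubW` is empty). -/
theorem BottomRankOneAdditive_of :
    Summit.BirchSwinnertonDyer.BirchSwinnertonDyer.Theses.AdditiveKolyvaginRoad.BottomRankOneAdditive := by
  intro W _ _ _ p _ K _ _ Dt β ι hp hadd hs hsp htwo htam hr hK hodd hlt hH hL hβ hc hSel
  refine stub_kolyvaginClassOneOfNotPDiv W p K Dt β ι hp hs hK hlt hH hβ ?_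
  rcases Summit.BirchSwinnertonDyer.Rank1Residual.Additive.subM_or_subGord_or_subTprime_of_addv W p hp hadd
    with h | h | h
  · exact stub_heegnerPointIndivisibleAbelianType W p K Dt β ι hp hadd (Or.inl h) hs hsp htwo htam hr hK hodd hlt
      hH hL hβ hc hSel
  · exact stub_heegnerPointIndivisibleAbelianType W p K Dt β ι hp hadd (Or.inr h) hs hsp htwo htam hr hK hodd hlt
      hH hL hβ hc hSel
  · exact stub_heegnerPointIndivisibleSupercuspidalType W p K Dt β ι hp hadd h hs hsp htwo htam hr hK hodd hlt
      hH hL hβ hc hSel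

end Summit.BirchSwinnertonDyer.BirchSwinnertonDyer.Cruxes.BottomRankOneAdditive.Birth

end
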